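import Summits.QuantumFields.YangMills.Theorems.IR.PressureMonotoneTMFloor
import Summits.QuantumFields.YangMills.Theorems.IR.LargeFieldRarityDefs
import Summits.QuantumFields.YangMills.Theorems.EquipartitionCriticalityFreeEnergyLogCoefficient
import Literature.MathematicalPhysics.QuantumFieldTheory.ChatterjeeScaleComparison

/-!
# Pressure-monotone-TM supplier, file 2∕4: the CEILING with boundary cost only and (FE) above the LINEAR volume floor `⌈β⌉₊ + 2`

Landed for item `stmt-QuantumFields-19354` (`--supports … --as helper`) by the LEAD prover ab-p1 under director-ym RULING g9-№2 ∕ №14 (3)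
(critic ym-ir-crit-2 03:04:13Z ∕ 03:14:37Z: PASS as supplier); authored by ideator ym-ir-idea-5 g7, split of the sorry-free workfile
`Cruxes/IR/Lines/pressure_monotone_tm.lean` v5 (Part B = `Cruxes/IR/Lines/rp_doubling.lean`) per `Cruxes/IR/Lines/pressure_monotone_tm_LANDING.md`
(eight files: `SiteRPGeometry` → `SiteRPDoubling` → `SiteRPZdBoxes` → `SiteRPFreeCubeDoubling`; `PressureMonotoneTMFloor` → `…LinearFloor` → `…LogFloor` → `…Equipartition`).

Content (§4): `torusLogPartition_le_freeBox` (`log Z_{Λ_{n+1},β} ≤ (n+1)⁴ f(β) + 10β(N+M)·#planes·(n+1)³`), `finiteSize_linear`, `linFloor`, `linFloor_le_sq`,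
`increment_bound_of_tendsto`, ★ `freeEnergyIncrementFrom_linFloor : FreeEnergyIncrementFrom linFloor` — where `FreeEnergyIncrementFrom` is idea-4's landed
definition (`LargeFieldRarityChessboard.FreeEnergyIncrementFrom`, `Theorems/IR/LargeFieldRarityDefs.lean`); (FE∞) enters through the tree's Chatterjee theorem
`freeEnergyLogCoefficient_proof` (route `EquipartitionCriticality`, item 8759 closed — the one Theses-cone import).

HONESTY.  Supplier ∕ kinematic content only (holds for `U(1)` too): nothing here proves the Yang–Mills mass gap (Clay), `BalabanLadder.IR`,
`BalabanLadder.NT` or a lattice gap; R4 closes only the conditional finite-𝕋⁴ rung `BalabanLadder.UV`.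
-/

noncomputable section

open scoped Topology
open Filter MeasureTheory
open Literature.MathematicalPhysics.QuantumFieldTheory Literature.MathematicalPhysics.QuantumLattice
open Summit.QuantumFields.YangMills.Cruxes.IR.AspectBootstrap (HasSpectralDatum IsAxisSymmetric mul_log_le phi
  phi_ge_of_lower axisSymmetric)

namespace Summit.QuantumFields.YangMills.Cruxes.IR.PressureMonotoneTM

open Summit.QuantumFields.YangMills.Cruxes.IR.LargeFieldRarityChessboard (FreeEnergyIncrementFrom)

/-! ## §4 The CEILING with boundary cost only, and the LINEAR volume floor for the rarity engine

The floor of §2 is exact; the ceiling below loses `β` per BOUNDARY plaquette only (one free cube `B_{L-1}` inside the torus: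
the tree's sub-box estimate `FreeEnergy.abs_torusLogPartition_sub_le` at `q = 1`, `m = L`; dropping the plaquettes of
`𝔅⟦L-1⟧ ∖ cubePlaqs (L-1)` raises `Z` at `β ≥ 0`; Chatterjee's Lemma 17.5 `ChatterjeeFreeEnergy.le_freeEnergyDensity` prices the
free cube against `f`).  Result: `log Z_{Λ_L,β} ≤ L⁴ f(β) + C_r β L³` — so `|log Z_{Λ_L,β} − L⁴ f(β)| ≤ C_r β L³`, against the
`C(1+β)(L⁴/m + L³m)`, `m² ≤ L` of `LargeFieldRarityChessboard.FiniteSizeFreeEnergy` (idea-4 g3), whose optimum forces the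
QUADRATIC floor `volFloor β = (⌈β⌉₊+2)²`.  Consequence: the free-energy increment (FE) of the large-field rarity engine holds
above the LINEAR floor `linFloor β = ⌈β⌉₊ + 2` (`freeEnergyIncrementFrom_linFloor`, Prop mirrored verbatim from idea-4's
`FreeEnergyIncrementFrom`), hence — by idea-4's PROVED, floor-parametric engine `largeFieldRarityOn_of_ZRatio chessboardZRatio_odd`
— β-uniform Peierls-multiplicative large-field rarity on ALL ODD TORI `2S+1 ≥ ⌈β⌉₊ + 2` (was `≥ (⌈β⌉₊+2)²`); the small-tori
residual `LargeFieldRaritySmallTori` shrinks to `3 ≤ 2S+1 ≤ ⌈β⌉₊ + 1`. -/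

section LinearFloor

variable {G : Type} [Group G] [TopologicalSpace G] [IsTopologicalGroup G] [CompactSpace G]
  [MeasurableSpace G] [BorelSpace G]

open Literature.Probability.LatticeModels (halfOpenBox)

/-- **Torus ceiling by one free cube** (`d = 4`, `β ≥ 0`, continuous `ρ` with `Re tr ρ ≤ N`, `|Re tr ρ| ≤ M`):
`log Z_{Λ_{n+1},β} ≤ (n+1)⁴ f(β) + 10·β(N+M)·#planes·(n+1)³`. -/
theorem torusLogPartition_le_freeBox [SecondCountableTopology G] {N : ℕ} (ρ : G →* Matrix (Fin N) (Fin N) ℂ)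
    (hρ : Continuous ρ) (hρN : ∀ g, (ρ g).trace.re ≤ N) {M : ℝ} (hM : ∀ g, |(ρ g).trace.re| ≤ M) {β : ℝ}
    (hβ : 0 ≤ β) (n : ℕ) :
    torusLogPartition 4 ρ β (n + 1) ≤ ((n : ℝ) + 1) ^ 4 * freeEnergyDensity 4 ρ β +
      10 * (β * (N + M) * Fintype.card {q : Fin 4 × Fin 4 // q.1 < q.2}) * ((n : ℝ) + 1) ^ 3 := by
  have hM0 : 0 ≤ M := (abs_nonneg _).trans (hM 1)
  have hK0 : 0 ≤ β * (N + M) * Fintype.card {q : Fin 4 × Fin 4 // q.1 < q.2} := by positivity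
  -- (i) the torus against the box `𝔅⟦n⟧` of ONE cube (`q = 1`, `m = n + 1`)
  have h1 := FreeEnergy.abs_torusLogPartition_sub_le (d := 4) ρ hρ hM β (n + 1) (n + 1) le_add_self
  have hq : (n + 1) / (n + 1) = 1 := Nat.div_self n.succ_pos
  simp only [hq, one_pow, Nat.cast_one, one_mul, Nat.add_sub_cancel, abs_of_nonneg hβ] at h1
  obtain ⟨-, h1'⟩ := abs_le.1 h1
  push_cast at h1'
  -- (ii) dropping the non-genuine plaquettes of `𝔅⟦n⟧` raises `Z` to the free cube `Z(B_n)`; (iii) Lemma 17.5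
  have h3 := ChatterjeeFreeEnergy.le_freeEnergyDensity (d := 4) ρ hρ hM β n
  push_cast at h3
  have hL0 : (0 : ℝ) < (n : ℝ) + 1 := by positivity
  have h3' : Real.log (zdPartitionFunction ρ β (halfOpenBox 4 n)).toReal ≤
      ((n : ℝ) + 1) ^ 4 * freeEnergyDensity 4 ρ β +
        β * (N + M) * Fintype.card {q : Fin 4 × Fin 4 // q.1 < q.2} * 6 * ((n : ℝ) + 1) ^ 3 := by
    have hL4 : (0 : ℝ) < ((n : ℝ) + 1) ^ 4 := by positivity
    have h3a := sub_le_iff_le_add.1 h3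
    rw [div_le_iff₀ hL4] at h3a
    have e : (freeEnergyDensity 4 ρ β +
        |β| * (N + M) * Fintype.card {q : Fin 4 × Fin 4 // q.1 < q.2} * (4 + 2) / ((n : ℝ) + 1)) *
          ((n : ℝ) + 1) ^ 4 = ((n : ℝ) + 1) ^ 4 * freeEnergyDensity 4 ρ β +
        β * (N + M) * Fintype.card {q : Fin 4 × Fin 4 // q.1 < q.2} * 6 * ((n : ℝ) + 1) ^ 3 := by
      rw [abs_of_nonneg hβ]
      field_simp
      ring
    linarith [h3a, e]
  -- (iv) `(n+1)⁴ − n⁴ ≤ 4 (n+1)³`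
  have h4 := ChatterjeeFreeEnergy.pow_succ_sub_pow_le n 4
  norm_num at h4
  have h4fix : ((n : ℝ) + 1) ^ 4 - (n : ℝ) ^ 4 ≤ 4 * ((n : ℝ) + 1) ^ 3 := by linarith
  have hβNM : 0 ≤ β * (N + M) := by positivity
  have h4' : β * (N + M) * (Fintype.card {q : Fin 4 × Fin 4 // q.1 < q.2} * (((n : ℝ) + 1) ^ 4 - (n : ℝ) ^ 4)) ≤
      β * (N + M) * (Fintype.card {q : Fin 4 × Fin 4 // q.1 < q.2} * (4 * ((n : ℝ) + 1) ^ 3)) :=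
    mul_le_mul_of_nonneg_left (mul_le_mul_of_nonneg_left h4fix (Nat.cast_nonneg _)) hβNM
  -- glue: `g ≤ log Z(𝔅⟦n⟧) + … ≤ log Z(B_n) + …`
  have key : ∀ {z : ℝ}, torusLogPartition 4 ρ β (n + 1) - z ≤
      β * (N + M) * (Fintype.card {q : Fin 4 × Fin 4 // q.1 < q.2} * (((n : ℝ) + 1) ^ 4 - (n : ℝ) ^ 4)) →
      z ≤ Real.log (zdPartitionFunction ρ β (halfOpenBox 4 n)).toReal →
      torusLogPartition 4 ρ β (n + 1) ≤ ((n : ℝ) + 1) ^ 4 * freeEnergyDensity 4 ρ β +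
        10 * (β * (N + M) * Fintype.card {q : Fin 4 × Fin 4 // q.1 < q.2}) * ((n : ℝ) + 1) ^ 3 :=
    fun ha hb => by linarith
  refine key h1' (Real.log_le_log (FreeEnergy.zdZ_pos ρ hρ β _) ?_)
  rw [ChatterjeeFreeEnergy.zdPartitionFunction_toReal_eq ρ hρ β n]
  exact integral_mono (FreeEnergy.integrable_boxWeight ρ hρ β _) (FreeEnergy.integrable_boxWeight ρ hρ β _)
    fun U => ChatterjeeFreeEnergy.prod_boxWeight_le_of_subset ρ hρN hβ (ChatterjeeFreeEnergy.cubePlaqs_subset n) U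

/-- **Two-sided finite-size bound, LINEAR in `β`, CUBIC in `L`**: for every lattice representation `r` there is `C ≥ 0` with
`L⁴ f(β) ≤ log Z_{Λ_L,β} ≤ L⁴ f(β) + C β L³` for all `β ≥ 0`, `L ≥ 2` (floor: §2, transfer matrix, exact; ceiling: one free
cube). -/
theorem finiteSize_linear (r : LatticeRep G) : ∃ C : ℝ, 0 ≤ C ∧ ∀ (β : ℝ), 0 ≤ β → ∀ (L : ℕ) [NeZero L], 2 ≤ L →
    (L : ℝ) ^ 4 * freeEnergyDensity 4 r.ρ β ≤ torusLogPartition 4 r.ρ β L ∧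
      torusLogPartition 4 r.ρ β L ≤ (L : ℝ) ^ 4 * freeEnergyDensity 4 r.ρ β + C * β * (L : ℝ) ^ 3 := by
  haveI : SecondCountableTopology G :=
    (r.continuous.isClosedEmbedding r.injective).isEmbedding.secondCountableTopology
  have hM : ∀ g, |(r.ρ g).trace.re| ≤ (r.N : ℝ) := fun g => by
    simpa [Fintype.card_fin] using
      Literature.RepresentationTheory.CompactGroups.CompactGroup.abs_re_trace_le_card r.ρ r.continuous g
  have hρN : ∀ g, (r.ρ g).trace.re ≤ (r.N : ℝ) := fun g => (abs_le.1 (hM g)).2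
  refine ⟨10 * (((r.N : ℝ) + r.N) * Fintype.card {q : Fin 4 × Fin 4 // q.1 < q.2}), by positivity,
    fun β hβ L _ hL => ⟨volume_mul_freeEnergyDensity_le_torusLogPartition r hβ L hL, ?_⟩⟩
  obtain ⟨n, hn⟩ : ∃ n, L = n + 1 := ⟨L - 1, by omega⟩
  subst hn
  have h := torusLogPartition_le_freeBox r.ρ r.continuous hρN hM hβ n
  push_cast
  linarith

-- `FreeEnergyIncrementFrom` is idea-4's LANDED def `Summit.QuantumFields.YangMills.Cruxes.IR.LargeFieldRarityChessboard.FreeEnergyIncrementFrom`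
-- (`Theorems/IR/LargeFieldRarityDefs.lean`, p605532), opened above — the workfile's verbatim mirror is dropped (LANDING manifest, «Dedup»).

/-- **The LINEAR volume floor** `L₀(β) = ⌈β⌉₊ + 2` (against idea-4's quadratic `(⌈β⌉₊ + 2)²`). -/
def linFloor (β : ℝ) : ℕ := ⌈β⌉₊ + 2

/-- `linFloor β ≤ volFloor β = (⌈β⌉₊+2)²` — every statement above the quadratic floor is implied by the same statement above the
linear one. -/
theorem linFloor_le_sq (β : ℝ) : linFloor β ≤ (⌈β⌉₊ + 2) * (⌈β⌉₊ + 2) := by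
  unfold linFloor
  nlinarith [Nat.zero_le ⌈β⌉₊]

/-- **The increment bound above the linear floor, from any asymptotic `f(β) + c log β → K`** (any real `c`): there are `C`, `β₃ > 0`
with `log Z_L(β') − log Z_L(β) ≤ c L⁴ log(β/β') + C L⁴` for `β₃ ≤ β' ≤ β`, `L ≥ ⌈β⌉₊ + 2` (ceiling at `β'`: `C_r β' L³ ≤ C_r L⁴`
since `β' ≤ β ≤ L`; floor at `β`: exact; `f(β') − f(β) ≤ c log(β/β') + 2`). -/
theorem increment_bound_of_tendsto (r : LatticeRep G) {c K : ℝ}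
    (hK : Tendsto (fun β : ℝ => freeEnergyDensity 4 r.ρ β + c * Real.log β) atTop (𝓝 K)) :
    ∃ C β₃ : ℝ, 0 < β₃ ∧ ∀ (L : ℕ) [NeZero L] (β' β : ℝ), β₃ ≤ β' → β' ≤ β → linFloor β ≤ L →
      torusLogPartition 4 r.ρ β' L - torusLogPartition 4 r.ρ β L ≤
        c * (L : ℝ) ^ 4 * Real.log (β / β') + C * (L : ℝ) ^ 4 := by
  obtain ⟨N₀, hN₀⟩ := (Metric.tendsto_atTop.1 hK) 1 one_pos
  obtain ⟨C₁, hC₁, hFS⟩ := finiteSize_linear r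
  refine ⟨2 + C₁, max N₀ 1, lt_of_lt_of_le one_pos (le_max_right _ _), fun L _ β' β hβ' hβ'β hfl => ?_⟩
  have hβ'1 : 1 ≤ β' := le_trans (le_max_right _ _) hβ'
  have hβ'0 : 0 < β' := by linarith
  have hβ0 : 0 < β := by linarith
  have hL2 : 2 ≤ L := le_trans (by unfold linFloor; omega) hfl
  have hLβ : β ≤ (L : ℝ) := by
    have h1 : β ≤ (⌈β⌉₊ : ℝ) := Nat.le_ceil β
    have h2 : ((⌈β⌉₊ + 2 : ℕ) : ℝ) ≤ (L : ℝ) := by exact_mod_cast hfl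
    push_cast at h2
    linarith
  have hLr : (0 : ℝ) ≤ (L : ℝ) ^ 3 := by positivity
  have hL4 : (0 : ℝ) ≤ (L : ℝ) ^ 4 := by positivity
  -- the two Chatterjee windows
  have hw' := hN₀ β' (le_trans (le_max_left _ _) hβ')
  have hw := hN₀ β (le_trans (le_trans (le_max_left _ _) hβ') hβ'β)
  rw [Real.dist_eq] at hw hw'
  have hf : freeEnergyDensity 4 r.ρ β' - freeEnergyDensity 4 r.ρ β ≤ c * Real.log (β / β') + 2 := by
    rw [Real.log_div hβ0.ne' hβ'0.ne']
    have a1 := (abs_lt.1 hw').2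
    have a2 := (abs_lt.1 hw).1
    nlinarith
  -- ceiling at `β'`, floor at `β`
  obtain ⟨-, hceil⟩ := hFS β' hβ'0.le L hL2
  obtain ⟨hfloor, -⟩ := hFS β hβ0.le L hL2
  have hb : C₁ * β' * (L : ℝ) ^ 3 ≤ C₁ * (L : ℝ) ^ 4 := by
    have : β' * (L : ℝ) ^ 3 ≤ (L : ℝ) * (L : ℝ) ^ 3 := mul_le_mul_of_nonneg_right (by linarith) hLr
    nlinarith
  have hmain : (L : ℝ) ^ 4 * (freeEnergyDensity 4 r.ρ β' - freeEnergyDensity 4 r.ρ β) ≤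
      (L : ℝ) ^ 4 * (c * Real.log (β / β') + 2) := mul_le_mul_of_nonneg_left hf hL4
  nlinarith

/-- **(FE) ABOVE THE LINEAR FLOOR — PROVED for every compact simple `G` and lattice representation** (`ν₀ = 3D/2` from the tree's
`freeEnergyLogCoefficient_proof`).  With idea-4's proved engine (`largeFieldRarityOn_of_ZRatio chessboardZRatio_odd`) this gives the
β-uniform large-field rarity on all odd tori `2S+1 ≥ ⌈β⌉₊ + 2`. -/
theorem freeEnergyIncrementFrom_linFloor : FreeEnergyIncrementFrom linFloor := by
  intro G _ _ _ _ hG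
  letI : MeasurableSpace G := borel G
  haveI : BorelSpace G := ⟨rfl⟩
  intro r
  obtain ⟨K, hK⟩ := Summit.QuantumFields.YangMills.Theorems.freeEnergyLogCoefficient_proof G hG r
  obtain ⟨C, β₃, hβ₃, h⟩ := increment_bound_of_tendsto r hK
  exact ⟨_, C, β₃, hβ₃, h⟩

end LinearFloor

end Summit.QuantumFields.YangMills.Cruxes.IR.PressureMonotoneTM

end
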